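import Mathlib.Tactic.Linarith
import Mathlib.Tactic.NormNum
import Mathlib.Tactic.Ring
import HarnessLib

/-!
# The (0,1) cell of the ι-window, XL (companion B): the product ground `B₁ × B₂`, XXVII — THE CORNER XII, ADDENDUM 1
# (report [XL] `H2-ZERO-ONE-40.md` §13): arithmetic shadow of PROPOSITION GRAPH-THICK and THEOREM THICK-ONE

Family `hodge`, b2b cell `hweil` (helper of item stmt-HodgeConjecture-2524). Report
`run/shared/lean/b2b/hodge-weil/b2b-hweil-pv1-g52/H2-ZERO-ONE-40.md` ([XL]) §13 (ADDENDUM 1). Context (the report's words, nothing of them formalised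
here): the generic algebra of a THICK two-block S-line with x̃-blocks `(b₁, b₂)` has the normal form `e² = φ + ψe`, `x̃^{b₂}e = 0`, `x̃^{b₁} = 0` with
`φ ∈ (x̃²)`, `ψ ∈ (x̃)`; being a complete intersection forces `b₁ = b₂` or `ord φ = b₁ − b₂`, so `b₁ − b₂ ≠ 1`; for `b₂ = 1` LEMMA COINCIDENCE forces
`ord c′ ≥ b₁ − 1`, the line contains the trivial structure `(m − 2)Θ × {z}`, and its embedded length in `S` is `m² + 2m + 2 + τ/2`, of which at most `7m`
is absorbed by the seven S-fibre units, against `|P′| ≤ 348`: `m ≤ 21 < 44`. The theorem below is the integer arithmetic. It claims no geometry. HONEST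
FRAMING: census work inside the ladder's H2 test ((0,1) cell) on the SPECIAL fourfold `X₀`; nothing here is a rung; no case of the Hodge conjecture is
proved; no statement of [Markman 2025] / [Perry 2026] / [EdGFS 2025] is used.
-/

-- mandated namespace `Summit.HodgeConjecture.HodgeConjecture.…` (Problem = Summit) trips `linter.dupNamespace`; the lakefile disables it
-- tree-wide (weak option), restated here so stand-alone elaboration is warning-free too.
set_option linter.dupNamespace false

namespace Summit.HodgeConjecture.HodgeConjecture.WeilTypeLadder

section ProductGroundTwentySevenB

/-- **[XL] 13.1–13.3 (PROPOSITION GRAPH-THICK, THEOREM THICK-ONE).** (a) l.c.i. + thick: if `b₂ < b₁` then `ord φ = b₁ − b₂` and `ord φ ≥ 2`, so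
`b₁ − b₂ ≥ 2` (the difference is never 1). (b) COINCIDENCE at `b₂ = 1`: `ρ ≥ min(1 + κ, b₁ − 1)` and `ρ < 1 + κ` force `κ ≥ b₁ − 1`. (c) the S-load of
the resulting structure: `(4m + T) + (m − 2)² + 2(m − 2) + 2 = m² + 2m + 2 + T`; with `T ≥ 0`, absorption `≤ 7m` and `|P′| = 2B + 14d₃ + 16 ≤ 348`
(`d₃ ≤ 12`, `B = 34 + 4d₃`): `m² − 5m + 2 ≤ 348`, hence `m ≤ 21`, against `m ≥ 44` in the five `h′ = 2` cells. [`omega`, `nlinarith`] -/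
theorem pg27b_thick_one :
    (∀ b₁ b₂ o : ℕ, b₂ < b₁ → o = b₁ - b₂ → 2 ≤ o → 2 ≤ b₁ - b₂ ∧ b₁ - b₂ ≠ 1) ∧
    (∀ κ b₁ ρ : ℕ, 1 ≤ κ → (1 + κ ≤ ρ ∨ b₁ - 1 ≤ ρ) → ρ < 1 + κ → b₁ - 1 ≤ κ) ∧
    (∀ m T : ℤ, (4 * m + T) + (m - 2) ^ 2 + 2 * (m - 2) + 2 = m ^ 2 + 2 * m + 2 + T) ∧
    (∀ d₃ : ℤ, 8 ≤ d₃ → d₃ ≤ 12 → 2 * (34 + 4 * d₃) + 14 * d₃ + 16 ≤ 348) ∧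
    (∀ m T P : ℤ, 0 ≤ m → 0 ≤ T → m ^ 2 + 2 * m + 2 + T - 7 * m ≤ P → P ≤ 348 → m ≤ 21) ∧
    (∀ d₃ mh : ℤ, 8 ≤ d₃ → mh ≤ 22 → ¬ (34 + 4 * d₃ - mh ≤ 21)) := by
  refine ⟨fun b₁ b₂ o h1 h2 h3 => ⟨by omega, by omega⟩, fun κ b₁ ρ h1 h2 h3 => by omega, fun m T => by ring,
    fun d₃ h1 h2 => by omega, fun m T P hm hT h1 h2 => ?_, fun d₃ mh h1 h2 => by omega⟩
  by_contra hc
  have hc' : 22 ≤ m := by omega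
  nlinarith

end ProductGroundTwentySevenB

end Summit.HodgeConjecture.HodgeConjecture.WeilTypeLadder
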